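import Literature.ModelTheory.Zilber.EACTorusScalings
import HarnessLib

/-!
# Torus-ruled varieties, II: an aperiodic hypersurface is dense modulo every lattice direction

Zilber's Exponential-Algebraic Closedness, case ladder (host summit Schanuel, cell `pub-schanuel`,
seat 2).  The algebraic input of the structural sub-rung `ZilberEacTorusRuled.lean`:

**Theorem** (`denseModDir_of_not_isPeriodVec`). Let `S ⊆ F^{d+1}` have prime vanishing ideal and
Zariski dimension `d` (so `I(S) = (h)` is principal, `exists_irreducible_vanishingIdeal_eq_span`),
and let `ν ∈ ℤ^{d+1}`.  If `S + F·ν` is NOT Zariski dense, then `ν` is a period vector of `S`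
(`IsPeriodVec`): the closure of `S` is a cylinder in the direction `ν`.

Proof (parametric translation).  If `p ≠ 0` vanishes at all `x + tν` (`x ∈ S`, `t ∈ F`), then every
`S`-coefficient of `p(X + Sν) ∈ F[X][S]` lies in `(h)`, so `h(X) ∣ p(X + Sν)` in `F[X][S]`; apply
the substitution `X ↦ X - Sν` (an endomorphism of `F[X][S]` fixing `S`): `h(X - Sν) ∣ p(X)`.  As
`p(X)` has `S`-degree `0` and `F[X][S]` is a domain, `h(X - Sν)` has `S`-degree `0`, i.e. equals its
value `h(X)` at `S = 0`; evaluating at `S = -1` gives `h(X + ν) = h(X)`, so `(h)` is `ν`-stable.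

Honest framing: elementary commutative algebra; nothing about `EC(3,2)` (OPEN) or Schanuel's
conjecture is asserted.
-/

noncomputable section

open MvPolynomial
open Literature.NumberTheory.Transcendental Literature.ModelTheory.Zilber

set_option linter.dupNamespace false

namespace Summit.Schanuel.Schanuel.Theorems

variable {F : Type*} [Field F] {m : ℕ}

/-! ## The parametric translation `p ↦ p(X + S ν)` -/

/-- **Parametric translation** along the integer direction `ν`: the `F`-algebra map
`F[X₁..X_m] → F[X₁..X_m][S]`, `p ↦ p(X + S ν)` (`Xᵢ ↦ Xᵢ + νᵢ S`). [folklore] -/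
def lineSubst (ν : Fin m → ℤ) :
    MvPolynomial (Fin m) F →ₐ[F] Polynomial (MvPolynomial (Fin m) F) :=
  aeval fun i => Polynomial.C (X i) + Polynomial.C (C (ν i : F)) * Polynomial.X

/-- `lineSubst ν Xᵢ = Xᵢ + νᵢ S`. [folklore] -/
theorem lineSubst_X (ν : Fin m → ℤ) (i : Fin m) :
    lineSubst ν (X i : MvPolynomial (Fin m) F) =
      Polynomial.C (X i) + Polynomial.C (C (ν i : F)) * Polynomial.X :=
  aeval_X _ _

/-- `lineSubst ν` on constants. [folklore] -/
theorem lineSubst_C (ν : Fin m → ℤ) (a : F) :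
    lineSubst ν (C a : MvPolynomial (Fin m) F) = Polynomial.C (C a) := by
  rw [lineSubst, algHom_C, Polynomial.algebraMap_apply, MvPolynomial.algebraMap_eq]

/-- **Evaluation rule**: `p(X + Sν)` at `X = x`, `S = t` is `p(x + tν)`. [folklore] -/
theorem eval_map_lineSubst (ν : Fin m → ℤ) (p : MvPolynomial (Fin m) F) (x : Fin m → F) (t : F) :
    ((lineSubst ν p).map (eval x)).eval t = eval (x + t • fun i => (ν i : F)) p := by
  have key : ((Polynomial.evalRingHom t).comp (Polynomial.mapRingHom (eval x))).comp
      (lineSubst (F := F) ν).toRingHom = (eval (x + t • fun i => (ν i : F))) := by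
    refine MvPolynomial.ringHom_ext (fun a => ?_) (fun i => ?_)
    · simp only [RingHom.coe_comp, Function.comp_apply, Polynomial.coe_mapRingHom,
        Polynomial.coe_evalRingHom, eval_C]
      rw [AlgHom.toRingHom_eq_coe, RingHom.coe_coe, lineSubst_C, Polynomial.map_C, eval_C,
        Polynomial.eval_C]
    · simp only [RingHom.coe_comp, Function.comp_apply, Polynomial.coe_mapRingHom,
        Polynomial.coe_evalRingHom, eval_X, Pi.add_apply, Pi.smul_apply, smul_eq_mul]
      rw [AlgHom.toRingHom_eq_coe, RingHom.coe_coe, lineSubst_X]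
      simp only [Polynomial.map_add, Polynomial.map_mul, Polynomial.map_C, Polynomial.map_X,
        eval_X, eval_C, Polynomial.eval_add, Polynomial.eval_mul, Polynomial.eval_C,
        Polynomial.eval_X]
      ring
  have := DFunLike.congr_fun key p
  simpa only [RingHom.coe_comp, Function.comp_apply, AlgHom.toRingHom_eq_coe, RingHom.coe_coe,
    Polynomial.coe_mapRingHom, Polynomial.coe_evalRingHom] using this

/-- The substitution extended to `F[X][S]` fixing `S`: `∑ₖ cₖ(X) Sᵏ ↦ ∑ₖ cₖ(X + Sν) Sᵏ`.
[folklore] -/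
def lineSubstHom (ν : Fin m → ℤ) :
    Polynomial (MvPolynomial (Fin m) F) →+* Polynomial (MvPolynomial (Fin m) F) :=
  Polynomial.eval₂RingHom (lineSubst ν).toRingHom Polynomial.X

/-- `lineSubstHom ν` on constants of `F[X][S]`. [folklore] -/
theorem lineSubstHom_C (ν : Fin m → ℤ) (p : MvPolynomial (Fin m) F) :
    lineSubstHom ν (Polynomial.C p) = lineSubst ν p := by
  rw [lineSubstHom, Polynomial.coe_eval₂RingHom, Polynomial.eval₂_C]
  rfl

/-- `lineSubstHom ν` fixes `S`. [folklore] -/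
theorem lineSubstHom_X (ν : Fin m → ℤ) :
    lineSubstHom (F := F) ν Polynomial.X = Polynomial.X := by
  rw [lineSubstHom, Polynomial.coe_eval₂RingHom, Polynomial.eval₂_X]

/-- **Inverse substitutions**: `X ↦ X - Sν` undoes `X ↦ X + Sν`:
`lineSubstHom (-ν) (p(X + Sν)) = p(X)`. [folklore] -/
theorem lineSubstHom_neg_lineSubst (ν : Fin m → ℤ) (p : MvPolynomial (Fin m) F) :
    lineSubstHom (-ν) (lineSubst ν p) = Polynomial.C p := by
  have key : (lineSubstHom (F := F) (-ν)).comp (lineSubst ν).toRingHom = Polynomial.C := by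
    refine MvPolynomial.ringHom_ext (fun a => ?_) (fun i => ?_)
    · rw [RingHom.comp_apply, AlgHom.toRingHom_eq_coe, RingHom.coe_coe, lineSubst_C, lineSubstHom_C,
        lineSubst_C]
    · rw [RingHom.comp_apply, AlgHom.toRingHom_eq_coe, RingHom.coe_coe, lineSubst_X, map_add,
        map_mul, lineSubstHom_C, lineSubstHom_C, lineSubstHom_X, lineSubst_X, lineSubst_C]
      have hneg : (C (((-ν) i : ℤ) : F) : MvPolynomial (Fin m) F) = -C (ν i : F) := by
        rw [Pi.neg_apply, Int.cast_neg, C_neg]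
      rw [hneg, Polynomial.C_neg]
      ring
  have := DFunLike.congr_fun key p
  simpa only [RingHom.coe_comp, Function.comp_apply, AlgHom.toRingHom_eq_coe, RingHom.coe_coe]
    using this

/-- `p(X + Sν)` at `S = 0` is `p`. [folklore] -/
theorem eval_zero_lineSubst (ν : Fin m → ℤ) (p : MvPolynomial (Fin m) F) :
    (lineSubst ν p).eval 0 = p := by
  have key : (Polynomial.evalRingHom 0).comp (lineSubst (F := F) ν).toRingHom = RingHom.id _ := by
    refine MvPolynomial.ringHom_ext (fun a => ?_) (fun i => ?_)
    · rw [RingHom.comp_apply, AlgHom.toRingHom_eq_coe, RingHom.coe_coe, lineSubst_C,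
        Polynomial.coe_evalRingHom, Polynomial.eval_C, RingHom.id_apply]
    · rw [RingHom.comp_apply, AlgHom.toRingHom_eq_coe, RingHom.coe_coe, lineSubst_X,
        Polynomial.coe_evalRingHom, RingHom.id_apply]
      simp
  have := DFunLike.congr_fun key p
  simpa only [RingHom.coe_comp, Function.comp_apply, AlgHom.toRingHom_eq_coe, RingHom.coe_coe,
    Polynomial.coe_evalRingHom, RingHom.id_apply] using this

/-- `p(X - Sν)` at `S = -1` is the translate `p(X + ν)` (`transl` of `EACAperiodicBase`).
[folklore] -/
theorem eval_neg_one_lineSubst_neg (ν : Fin m → ℤ) (p : MvPolynomial (Fin m) F) :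
    (lineSubst (-ν) p).eval (-1) = transl (fun i => (ν i : F)) p := by
  have key : (Polynomial.evalRingHom (-1)).comp (lineSubst (F := F) (-ν)).toRingHom =
      (transl (fun i => (ν i : F))).toRingHom := by
    refine MvPolynomial.ringHom_ext (fun a => ?_) (fun i => ?_)
    · rw [RingHom.comp_apply, AlgHom.toRingHom_eq_coe, RingHom.coe_coe, lineSubst_C,
        Polynomial.coe_evalRingHom, Polynomial.eval_C, AlgHom.toRingHom_eq_coe, RingHom.coe_coe,
        transl_C]
    · rw [RingHom.comp_apply, AlgHom.toRingHom_eq_coe, RingHom.coe_coe, lineSubst_X,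
        Polynomial.coe_evalRingHom, AlgHom.toRingHom_eq_coe, RingHom.coe_coe, transl_X]
      have hneg : (C (((-ν) i : ℤ) : F) : MvPolynomial (Fin m) F) = -C (ν i : F) := by
        rw [Pi.neg_apply, Int.cast_neg, C_neg]
      rw [hneg]
      simp
  have := DFunLike.congr_fun key p
  simpa only [RingHom.coe_comp, Function.comp_apply, AlgHom.toRingHom_eq_coe, RingHom.coe_coe,
    Polynomial.coe_evalRingHom] using this

/-! ## Aperiodic hypersurfaces are dense modulo every lattice direction -/

/-- **An irreducible hypersurface that is not `ν`-periodic is dense modulo `ν`.**  Let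
`S ⊆ F^{d+1}` (`F` infinite) have prime vanishing ideal and Zariski dimension `d`, and let
`ν ∈ ℤ^{d+1}` NOT be a period vector of `S`.  Then `S + F·ν` is Zariski dense: no nonzero
polynomial vanishes at all `x + tν`, `x ∈ S`, `t ∈ F`.  (Parametric translation:
`h(X) ∣ p(X + Sν)` in `F[X][S]` forces `h(X - Sν) ∣ p(X)`, hence `h(X - Sν) = h(X)`, hence
`h(X + ν) = h(X)`, where `I(S) = (h)`.) [folklore] -/
theorem denseModDir_of_not_isPeriodVec [Infinite F] {d : ℕ} {S : Set (Fin (d + 1) → F)}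
    (hS : (vanishingIdeal F S).IsPrime) (hdim : zariskiDim F S = d) {ν : Fin (d + 1) → ℤ}
    (hν : ¬ IsPeriodVec F S ν) : DenseModDir F ν S := by
  intro p hp
  by_contra hp0
  obtain ⟨h, -, hIS⟩ := exists_irreducible_vanishingIdeal_eq_span hS hdim
  -- (1) every `S`-coefficient of `p(X + Sν)` vanishes on `S`
  have hcoef : ∀ k, (lineSubst ν p).coeff k ∈ vanishingIdeal F S := by
    intro k
    rw [mem_vanishingIdeal_iff]
    intro x hx
    have hq : (lineSubst ν p).map (eval x) = 0 := by
      refine Polynomial.funext fun t => ?_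
      rw [eval_map_lineSubst, Polynomial.eval_zero]
      exact hp x hx t
    have := congrArg (fun q => Polynomial.coeff q k) hq
    simp only [Polynomial.coeff_map, Polynomial.coeff_zero] at this
    exact this
  -- (2) `h(X) ∣ p(X + Sν)` in `F[X][S]`
  have hdvd : Polynomial.C h ∣ lineSubst ν p := by
    rw [Polynomial.C_dvd_iff_dvd_coeff]
    intro k
    have := hcoef k
    rw [hIS] at this
    exact Ideal.mem_span_singleton.1 this
  -- (3) substitute `X ↦ X - Sν`: `h(X - Sν) ∣ p(X)`
  have hdvd' : lineSubst (-ν) h ∣ Polynomial.C p := by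
    have := map_dvd (lineSubstHom (-ν)) hdvd
    rwa [lineSubstHom_C, lineSubstHom_neg_lineSubst] at this
  -- (4) degrees: `h(X - Sν)` is constant in `S`, hence equals `h(X)`
  have hCp : (Polynomial.C p : Polynomial (MvPolynomial (Fin (d + 1)) F)) ≠ 0 := by
    rwa [Ne, Polynomial.C_eq_zero]
  have hdeg : (lineSubst (-ν) h).natDegree = 0 := by
    have := Polynomial.natDegree_le_of_dvd hdvd' hCp
    rw [Polynomial.natDegree_C] at this
    omega
  have hτh : lineSubst (-ν) h = Polynomial.C h := by
    rw [Polynomial.eq_C_of_natDegree_eq_zero hdeg, Polynomial.coeff_zero_eq_eval_zero,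
      eval_zero_lineSubst]
  -- (5) `h(X + ν) = h(X)`
  have hinv : transl (fun i => (ν i : F)) h = h := by
    have := congrArg (Polynomial.eval (-1 : MvPolynomial (Fin (d + 1)) F)) hτh
    rwa [eval_neg_one_lineSubst_neg, Polynomial.eval_C] at this
  -- (6) so `ν` is a period vector of `S`
  refine hν fun q hq => ?_
  rw [hIS] at hq ⊢
  obtain ⟨r, rfl⟩ := Ideal.mem_span_singleton'.1 hq
  rw [map_mul, hinv]
  exact Ideal.mem_span_singleton'.2 ⟨_, rfl⟩

/-- Corollary: an irreducible hypersurface WITHOUT integer period is dense modulo every nonzero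
lattice direction. [folklore] -/
theorem denseModDir_of_not_hasIntegerPeriod [Infinite F] {d : ℕ} {S : Set (Fin (d + 1) → F)}
    (hS : (vanishingIdeal F S).IsPrime) (hdim : zariskiDim F S = d) {ν : Fin (d + 1) → ℤ}
    (hν : ν ≠ 0) (haper : ¬ HasIntegerPeriod F S) : DenseModDir F ν S :=
  denseModDir_of_not_isPeriodVec hS hdim fun h => haper ⟨ν, hν, h⟩

end Summit.Schanuel.Schanuel.Theorems
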